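import Literature.Geometry.Kaehler.AnalyticSetRegularUnion
import Literature.Geometry.Kaehler.AnalyticSetSingularLocus
import Literature.Geometry.Kaehler.AnalyticSetProjection

/-!
# Stub `stub_regularPointOfFiniteUnion` (S2b/D; line `purity-sorted-hecke-envelope` / `HeckeGraphChow` of
# crux `EndoscopicMiddleDegree.OrthogonalEnveloped`, stmt-HodgeConjecture-14300): regular points of a finite
# union of closed pieces each analytic at the point, and locality of analyticity / regularity

Registered skeleton: `HeckeGraphChow` of crux `OrthogonalEnveloped`; intended as the file
`Theorems/EndoscopicMiddleDegreeOrthogonalEnvelopedRegularPointOfFiniteUnion.lean` of the summit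
(`--supports stmt-HodgeConjecture-14300`), sub-stub D of the construction stub `stub_heckeGraphAnalytic`
(near a point, the Hecke graph is a finite union of CLOSED pieces, each analytic at the point; its
regular points must be located on one piece).

WHAT IS PROVED (all for a charted space `M` over a model with corners `I : ModelWithCorners ℂ E H`;
the union statements under `[FiniteDimensional ℂ E] [IsManifold I 1 M] [I.Boundaryless]`, the
hypotheses of the two-set case `Literature.Geometry.Kaehler.IsRegularPointOfCodim.of_union`):

* `stub_regularPointOfFiniteUnion` (registered signature, binder for binder) and its `Type*`-polymorphic
  curried form `exists_isRegularPointOfCodim_of_biUnion_finset` — if `x` is a regular point of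
  codimension `q` of `⋃ i ∈ s, S i` (`s` a `Finset`), every `S i` being closed and analytic at `x`, then
  `x ∈ S i` and `x` is a regular point of codimension `q` of `S i` for some `i ∈ s`. Proof: `Finset`
  induction on the two-set case `IsRegularPointOfCodim.of_union` (`S` analytic at `x`, `S'` closed),
  exactly as in the tree's global version
  `Literature.Geometry.Kaehler.IsRegularPointOfCodim.exists_mem_of_biUnion_finset`
  (`HolomorphicChainRectifiable.lean`, which assumes every `S i` analytic on the whole of `M`); the
  closed set `S'` of the induction step is the finite union of the remaining pieces
  (`isClosed_biUnion_finset`).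
* `isAnalyticSetAt_biUnion_finset` — a finite union of sets analytic at `x` is analytic at `x`
  (pointwise form of `Literature.Geometry.Kaehler.isAnalyticSet_biUnion_finset`; induction on
  `IsAnalyticSetAt.union`).
* Locality ("germ") lemmas in the `Z ∩ O = Z' ∩ O` phrasing used by the assembly of the line:
  `isAnalyticSetAt_congr_of_inter_eq` (an `iff`; its two directions are the tree's
  `Literature.Geometry.Kaehler.IsAnalyticSetAt.congr_set`, `AnalyticSetProjection.lean`),
  `mem_regularLocus_congr_of_inter_eq` and `regularLocus_inter_eq_of_inter_eq` (from the tree's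
  `Literature.Geometry.Kaehler.IsRegularPointOfCodim.congr_set` / `isRegularPointOfCodim_congr_set`,
  `AnalyticSetSingularLocus.lean`, which is the regular-point locality lemma itself and is NOT restated
  here: use `IsRegularPointOfCodim.congr_set hO hx h hZ`). Both tree files are imported, so importing
  this module brings all four locality lemmas into scope.

Sources: E. M. Chirka, *Complex Analytic Sets* (1989), §2.1 (local analyticity), §2.3 (regular
points), §5.3 Cor. 2 (uniqueness theorem: `dim_x (S ∪ S') = max`); P. Griffiths, J. Harris,
*Principles of Algebraic Geometry* (1978), Ch. 0 §2.
-/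

noncomputable section

-- The crux-workfile namespace `Summit.<P>.<Sub>.Cruxes.…` repeats `HodgeConjecture` (single-conjunct summit).
set_option linter.dupNamespace false

namespace Summit.HodgeConjecture.HodgeConjecture.Cruxes.OrthogonalEnveloped.HeckeGraphChow

open scoped Manifold ContDiff Topology
open Set Filter
open Literature.Geometry.Kaehler

/-! ### Locality of analyticity and of the regular locus -/

section Locality

variable {E : Type*} [NormedAddCommGroup E] [NormedSpace ℂ E]
  {H : Type*} [TopologicalSpace H] {I : ModelWithCorners ℂ E H}
  {M : Type*} [TopologicalSpace M] [ChartedSpace H M]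

/-- **Analyticity at a point is a property of the germ.** If `Z` and `Z'` have the same trace on an
open neighbourhood `O` of `x`, then `Z` is analytic at `x` iff `Z'` is (shrink the neighbourhood
carrying the local equations to `U ∩ O`; both directions are
`Literature.Geometry.Kaehler.IsAnalyticSetAt.congr_set`). [cite: Chirka1989, §2.1] -/
theorem isAnalyticSetAt_congr_of_inter_eq {Z Z' O : Set M} {x : M} (hO : IsOpen O) (hx : x ∈ O)
    (h : Z ∩ O = Z' ∩ O) : IsAnalyticSetAt I Z x ↔ IsAnalyticSetAt I Z' x :=
  ⟨fun hZ => hZ.congr_set hO hx h, fun hZ' => hZ'.congr_set hO hx h.symm⟩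

/-- **Membership in the regular locus is a property of the germ.** If `Z` and `Z'` have the same
trace on an open neighbourhood `O` of `x` and `x ∈ reg Z`, then `x ∈ reg Z'`: `x ∈ Z'` since
`x ∈ Z ∩ O = Z' ∩ O`, and regularity of each codimension passes from `Z` to `Z'`
(`Literature.Geometry.Kaehler.IsRegularPointOfCodim.congr_set`). [cite: Chirka1989, §2.3] -/
theorem mem_regularLocus_congr_of_inter_eq {Z Z' O : Set M} {x : M} (hO : IsOpen O) (hx : x ∈ O)
    (h : Z ∩ O = Z' ∩ O) (hZ : x ∈ regularLocus I Z) : x ∈ regularLocus I Z' := by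
  obtain ⟨hxZ, p, hp⟩ := hZ
  exact ⟨(h.subset ⟨hxZ, hx⟩).1, p, hp.congr_set hO hx h⟩

/-- Two sets with the same trace on an open set `O` have regular loci with the same trace on `O`.
[cite: Chirka1989, §2.3] -/
theorem regularLocus_inter_eq_of_inter_eq {Z Z' O : Set M} (hO : IsOpen O) (h : Z ∩ O = Z' ∩ O) :
    regularLocus I Z ∩ O = regularLocus I Z' ∩ O := by
  ext x
  exact ⟨fun hx => ⟨mem_regularLocus_congr_of_inter_eq hO hx.2 h hx.1, hx.2⟩,
    fun hx => ⟨mem_regularLocus_congr_of_inter_eq hO hx.2 h.symm hx.1, hx.2⟩⟩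

/-- **A finite union of sets analytic at `x` is analytic at `x`** (`Finset`-indexed; induction on the
binary case `Literature.Geometry.Kaehler.IsAnalyticSetAt.union`, the empty union being the empty
set, analytic everywhere). Pointwise form of `Literature.Geometry.Kaehler.isAnalyticSet_biUnion_finset`.
[cite: Chirka1989, §2.1] -/
theorem isAnalyticSetAt_biUnion_finset {ι : Type*} (s : Finset ι) {Z : ι → Set M} {x : M}
    (h : ∀ i ∈ s, IsAnalyticSetAt I (Z i) x) : IsAnalyticSetAt I (⋃ i ∈ s, Z i) x := by
  classical
  induction s using Finset.induction_on with
  | empty =>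
    rw [show (⋃ i ∈ (∅ : Finset ι), Z i) = ∅ by simp]
    exact isAnalyticSet_empty x
  | insert a s ha ih =>
    rw [Finset.set_biUnion_insert]
    exact (h a (Finset.mem_insert_self a s)).union
      (ih fun i hi => h i (Finset.mem_insert_of_mem hi))

end Locality

/-! ### Regular points of a finite union of closed, locally analytic pieces -/

section Union

variable {E : Type*} [NormedAddCommGroup E] [NormedSpace ℂ E] [FiniteDimensional ℂ E]
  {H : Type*} [TopologicalSpace H] {I : ModelWithCorners ℂ E H} [I.Boundaryless]
  {M : Type*} [TopologicalSpace M] [ChartedSpace H M] [IsManifold I 1 M]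

-- adapted from `Literature.Geometry.Kaehler.IsRegularPointOfCodim.exists_mem_of_biUnion_finset`
-- (Literature/Geometry/Kaehler/HolomorphicChainRectifiable.lean), weakening "every `S i` analytic on
-- `M`" to "every `S i` closed and analytic at `x`".
/-- **A regular point of a finite union of closed sets, each analytic at the point, is a regular point
of the same codimension of one of them** (and lies in it). Induction on the `Finset` `s`: for
`s = insert a s'`, `⋃ i ∈ s, S i = S a ∪ ⋃ i ∈ s', S i` with `S a` analytic at `x` and the second set
closed (finite union of closed sets), so by the two-set case
`Literature.Geometry.Kaehler.IsRegularPointOfCodim.of_union` (identity principle at a regular point)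
either `x ∈ S a` is a regular point of codimension `q` of `S a`, or `x` is a regular point of
codimension `q` of `⋃ i ∈ s', S i` lying in it, and the induction hypothesis applies; the empty union
has no points. [cite: Chirka1989, §5.3 Cor. 2 with §2.3] -/
theorem exists_isRegularPointOfCodim_of_biUnion_finset {ι : Type*} (s : Finset ι) {S : ι → Set M}
    {q : ℕ} {x : M} (hS : ∀ i ∈ s, IsAnalyticSetAt I (S i) x) (hc : ∀ i ∈ s, IsClosed (S i))
    (hx : x ∈ regularLocus I (⋃ i ∈ s, S i)) (hq : IsRegularPointOfCodim I (⋃ i ∈ s, S i) q x) :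
    ∃ i ∈ s, x ∈ S i ∧ IsRegularPointOfCodim I (S i) q x := by
  classical
  induction s using Finset.induction_on with
  | empty =>
    simp only [Finset.notMem_empty, iUnion_of_empty, iUnion_empty] at hx
    exact absurd hx.1 (notMem_empty x)
  | insert a s ha ih =>
    have hu : (⋃ i ∈ insert a s, S i) = S a ∪ ⋃ i ∈ s, S i := Finset.set_biUnion_insert a s S
    rw [hu] at hx hq
    have hcl : IsClosed (⋃ i ∈ s, S i) :=
      isClosed_biUnion_finset fun i hi => hc i (Finset.mem_insert_of_mem hi)
    rcases hq.of_union (hS a (Finset.mem_insert_self a s)) hcl hx with ⟨hxa, h⟩ | ⟨hxs, h⟩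
    · exact ⟨a, Finset.mem_insert_self a s, hxa, h⟩
    · obtain ⟨i, hi, hxi, h'⟩ := ih (fun i hi => hS i (Finset.mem_insert_of_mem hi))
        (fun i hi => hc i (Finset.mem_insert_of_mem hi)) ⟨hxs, q, h⟩ h
      exact ⟨i, Finset.mem_insert_of_mem hi, hxi, h'⟩

end Union

/-- **Stub `stub_regularPointOfFiniteUnion` (S2b/D).** A regular point of codimension `q` of a finite
union `⋃ i ∈ s, S i` of CLOSED subsets of a complex manifold, each analytic at the point, lies in some
`S i`, `i ∈ s`, of which it is a regular point of codimension `q`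
(`exists_isRegularPointOfCodim_of_biUnion_finset`, in the binder layout of the registered stub;
pointwise form of the tree's `Literature.Geometry.Kaehler.forall_regularLocus_biUnion_finset_le` /
`IsRegularPointOfCodim.exists_mem_of_biUnion_finset`). [cite: Chirka1989, §5.3 Cor. 2 with §2.3] -/
theorem stub_regularPointOfFiniteUnion :
    ∀ {E : Type} [NormedAddCommGroup E] [NormedSpace ℂ E] [FiniteDimensional ℂ E]
      {H : Type} [TopologicalSpace H] {I : ModelWithCorners ℂ E H} [I.Boundaryless]
      {M : Type} [TopologicalSpace M] [ChartedSpace H M] [IsManifold I 1 M]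
      {ι : Type} (s : Finset ι) (S : ι → Set M) (x : M) (q : ℕ),
      (∀ i ∈ s, IsAnalyticSetAt I (S i) x) → (∀ i ∈ s, IsClosed (S i)) →
      x ∈ regularLocus I (⋃ i ∈ s, S i) → IsRegularPointOfCodim I (⋃ i ∈ s, S i) q x →
      ∃ i ∈ s, x ∈ S i ∧ IsRegularPointOfCodim I (S i) q x :=
  fun s _ _ _ hS hc hx hq => exists_isRegularPointOfCodim_of_biUnion_finset s hS hc hx hq

end Summit.HodgeConjecture.HodgeConjecture.Cruxes.OrthogonalEnveloped.HeckeGraphChow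

end
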